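import Summits.AtomisticToContinuum.HydrodynamicLimit.Theses.InformationPercolationEngine
import Summits.AtomisticToContinuum.HydrodynamicLimit.Theorems.InformationPercolationEngineChaosClosesEulerEnskogTensor
import Literature.MathematicalPhysics.KineticTheory.BoltzmannSolutionsUkaiVelocity
import HarnessLib

/-!
# A countable bounded continuous family is balance-determining

Helper for the line `Sketch` of the crux `InformationPercolationEngine.ChaosClosesEuler`
(stmt-AtomisticToContinuum-15141), skeleton v11 (`Cruxes/ChaosClosesEuler/Lines/Sketch.lean`), registered stub
`stub_balanceTestFamily`: there is a sequence `ψᵢ : ℝ³ → [−1, 1]` of continuous functions such that a finite measure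
with finite second moment whose collisional balance functional vanishes on every `ψᵢ` is balanced against ALL bounded
continuous tests.

Proof. `C(ℝ³, ℝ)` with the compact-open topology is second countable (Mathlib's
`ContinuousMap.instSecondCountableTopology`), hence so is the subspace of functions bounded by `1`; take a dense
sequence `ψᵢ` in it.  A bounded continuous test `ψ`, rescaled to `ψ/(C+1)`, is a compact-open (hence pointwise)
limit of a subsequence `ψ_{n_k}`, and the balance functional is continuous under bounded pointwise convergence
(dominated convergence three times: the integrand is bounded by `4 (|v| + |w|)`, integrable against a finite
measure with a first moment).  Linearity of the functional in `ψ` removes the rescaling.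

References: folklore (separability of `C(ℝ³)` in the compact-open topology + dominated convergence).
-/

noncomputable section

namespace Summit.AtomisticToContinuum.HydrodynamicLimit.Theorems.ChaosClosesEulerBalanceTestFamily

open scoped BigOperators Topology Classical MeasureTheory ENNReal InnerProductSpace
open Filter Set MeasureTheory
open Literature.MathematicalPhysics.KineticTheory
open Literature.MathematicalPhysics.KineticTheory.UkaiLanford
open Literature.Analysis.FluidPDE
open Summit.AtomisticToContinuum.HydrodynamicLimit.Theses
open Summit.AtomisticToContinuum.HydrodynamicLimit.Theses.InformationPercolationEngine

/-! ## Pointwise bounds and continuity of the balance integrand -/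

/-- `((v - w)·ω)₊ ≤ |v| + |w|`. [folklore] -/
theorem hardSphereKernel_le_norm_add_norm (v w : V3) (ω : Metric.sphere (0 : V3) 1) :
    hardSphereKernel (v, w) ω ≤ ‖v‖ + ‖w‖ := by
  refine max_le ?_ (by positivity)
  calc ⟪v - w, (ω : V3)⟫_ℝ ≤ ‖v - w‖ * ‖(ω : V3)‖ := real_inner_le_norm _ _
    _ = ‖v - w‖ := by rw [norm_eq_of_mem_sphere ω, mul_one]
    _ ≤ ‖v‖ + ‖w‖ := norm_sub_le v w

/-- The balance integrand `((v - w)·ω)₊ (ψ(v') + ψ(w') - ψ(v) - ψ(w))` of a test bounded by `1` is bounded by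
`4 (|v| + |w|)`. [folklore] -/
theorem abs_balanceIntegrand_le {ψ : V3 → ℝ} (hψ : ∀ v, |ψ v| ≤ 1) (v w : V3)
    (ω : Metric.sphere (0 : V3) 1) :
    |hardSphereKernel (v, w) ω *
        (ψ (collide ω (v, w)).1 + ψ (collide ω (v, w)).2 - ψ v - ψ w)| ≤ 4 * (‖v‖ + ‖w‖) := by
  rw [abs_mul, abs_of_nonneg (hardSphereKernel_nonneg' _ _)]
  obtain ⟨h1a, h1b⟩ := abs_le.1 (hψ (collide ω (v, w)).1)
  obtain ⟨h2a, h2b⟩ := abs_le.1 (hψ (collide ω (v, w)).2)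
  obtain ⟨h3a, h3b⟩ := abs_le.1 (hψ v)
  obtain ⟨h4a, h4b⟩ := abs_le.1 (hψ w)
  have h4 : |ψ (collide ω (v, w)).1 + ψ (collide ω (v, w)).2 - ψ v - ψ w| ≤ 4 :=
    abs_le.2 ⟨by linarith, by linarith⟩
  calc hardSphereKernel (v, w) ω * |ψ (collide ω (v, w)).1 + ψ (collide ω (v, w)).2 - ψ v - ψ w|
      ≤ (‖v‖ + ‖w‖) * 4 :=
        mul_le_mul (hardSphereKernel_le_norm_add_norm v w ω) h4 (abs_nonneg _) (by positivity)
    _ = 4 * (‖v‖ + ‖w‖) := by ring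

/-- The balance integrand of a continuous test is jointly continuous in `((v, w), ω)`. [folklore] -/
theorem continuous_balanceIntegrand {ψ : V3 → ℝ} (hψ : Continuous ψ) :
    Continuous (fun q : (V3 × V3) × Metric.sphere (0 : V3) 1 =>
      hardSphereKernel (q.1.1, q.1.2) q.2 *
        (ψ (collide q.2 (q.1.1, q.1.2)).1 + ψ (collide q.2 (q.1.1, q.1.2)).2 - ψ q.1.1 - ψ q.1.2)) := by
  have hr : Continuous fun q : (V3 × V3) × Metric.sphere (0 : V3) 1 => ((q.1.1, q.1.2), q.2) :=
    (continuous_fst.fst.prodMk continuous_fst.snd).prodMk continuous_snd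
  have hk : Continuous fun q : (V3 × V3) × Metric.sphere (0 : V3) 1 =>
      hardSphereKernel (q.1.1, q.1.2) q.2 :=
    (continuous_hardSphereKernel_uncurry (E := V3)).comp hr
  have hc : Continuous fun q : (V3 × V3) × Metric.sphere (0 : V3) 1 => collide q.2 (q.1.1, q.1.2) :=
    (continuous_collide_uncurry (E := V3)).comp hr
  exact hk.mul ((((hψ.comp hc.fst).add (hψ.comp hc.snd)).sub (hψ.comp continuous_fst.fst)).sub
    (hψ.comp continuous_fst.snd))

/-- The sphere integral of the balance integrand is jointly continuous in `(v, w)`. [folklore] -/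
theorem continuous_sphereIntegral_balance {ψ : V3 → ℝ} (hψ : Continuous ψ) :
    Continuous (Function.uncurry fun v w : V3 => ∫ ω : Metric.sphere (0 : V3) 1,
      hardSphereKernel (v, w) ω *
        (ψ (collide ω (v, w)).1 + ψ (collide ω (v, w)).2 - ψ v - ψ w) ∂sphereMeasure) :=
  continuous_integral_sphere (P := V3 × V3) (continuous_balanceIntegrand hψ)

/-! ## Continuity of the balance functional under bounded pointwise convergence -/

/-- **Bounded pointwise convergence passes through the balance functional.** If continuous tests `gₙ`
bounded by `1` converge pointwise to `h`, then, for a finite measure `m` with a first moment, the collisional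
balance `∫∫∫ ((v−w)·ω)₊ (gₙ(v') + gₙ(w') − gₙ(v) − gₙ(w)) dω dm dm` converges to that of `h` (dominated
convergence in `ω`, then in `w`, then in `v`). [folklore] -/
theorem tendsto_balance {m : Measure V3} [IsFiniteMeasure m]
    (hm : Integrable (fun v : V3 => ‖v‖) m) {g : ℕ → V3 → ℝ} {h : V3 → ℝ}
    (hg : ∀ n, Continuous (g n)) (hb : ∀ n v, |g n v| ≤ 1)
    (hlim : ∀ v, Tendsto (fun n => g n v) atTop (𝓝 (h v))) :
    Tendsto (fun n => ∫ v, ∫ w, ∫ ω : Metric.sphere (0 : V3) 1,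
        hardSphereKernel (v, w) ω *
          (g n (collide ω (v, w)).1 + g n (collide ω (v, w)).2 - g n v - g n w) ∂sphereMeasure ∂m ∂m)
      atTop (𝓝 (∫ v, ∫ w, ∫ ω : Metric.sphere (0 : V3) 1,
        hardSphereKernel (v, w) ω *
          (h (collide ω (v, w)).1 + h (collide ω (v, w)).2 - h v - h w) ∂sphereMeasure ∂m ∂m)) := by
  haveI := isFiniteMeasure_sphereMeasure (E := V3)
  set S : ℝ := (sphereMeasure : Measure (Metric.sphere (0 : V3) 1)).real univ
  -- Step 1: the sphere integrals converge, for all `v, w`.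
  have h1 : ∀ v w : V3, Tendsto (fun n => ∫ ω : Metric.sphere (0 : V3) 1,
      hardSphereKernel (v, w) ω *
        (g n (collide ω (v, w)).1 + g n (collide ω (v, w)).2 - g n v - g n w) ∂sphereMeasure)
      atTop (𝓝 (∫ ω : Metric.sphere (0 : V3) 1, hardSphereKernel (v, w) ω *
        (h (collide ω (v, w)).1 + h (collide ω (v, w)).2 - h v - h w) ∂sphereMeasure)) := by
    intro v w
    refine tendsto_integral_of_dominated_convergence (fun _ => 4 * (‖v‖ + ‖w‖)) ?_
      (integrable_const _) ?_ ?_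
    · intro n
      have hc := (continuous_balanceIntegrand (hg n)).comp (Continuous.prodMk_right (v, w))
      exact hc.aestronglyMeasurable
    · intro n
      exact Eventually.of_forall fun ω => by
        rw [Real.norm_eq_abs]; exact abs_balanceIntegrand_le (hb n) v w ω
    · exact Eventually.of_forall fun ω =>
        ((((hlim _).add (hlim _)).sub (hlim v)).sub (hlim w)).const_mul _
  -- Step 2: uniform bound on the sphere integrals.
  have h1b : ∀ n (v w : V3), ‖∫ ω : Metric.sphere (0 : V3) 1, hardSphereKernel (v, w) ω *
      (g n (collide ω (v, w)).1 + g n (collide ω (v, w)).2 - g n v - g n w) ∂sphereMeasure‖ ≤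
      S * (4 * (‖v‖ + ‖w‖)) := fun n v w =>
    norm_integral_sphere_le (fun ω => abs_balanceIntegrand_le (hb n) v w ω)
  have hbi : ∀ v : V3, Integrable (fun w : V3 => S * (4 * (‖v‖ + ‖w‖))) m := fun v =>
    (((integrable_const ‖v‖).fun_add hm).const_mul 4).const_mul S
  -- Step 3: the `w`-integrals converge, for all `v`.
  have h2 : ∀ v : V3, Tendsto (fun n => ∫ w, ∫ ω : Metric.sphere (0 : V3) 1,
      hardSphereKernel (v, w) ω *
        (g n (collide ω (v, w)).1 + g n (collide ω (v, w)).2 - g n v - g n w) ∂sphereMeasure ∂m)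
      atTop (𝓝 (∫ w, ∫ ω : Metric.sphere (0 : V3) 1, hardSphereKernel (v, w) ω *
        (h (collide ω (v, w)).1 + h (collide ω (v, w)).2 - h v - h w) ∂sphereMeasure ∂m)) := by
    intro v
    refine tendsto_integral_of_dominated_convergence (fun w => S * (4 * (‖v‖ + ‖w‖))) ?_ (hbi v)
      ?_ ?_
    · intro n
      have hc := (continuous_sphereIntegral_balance (hg n)).comp (Continuous.prodMk_right v)
      exact hc.aestronglyMeasurable
    · intro n
      exact Eventually.of_forall fun w => h1b n v w
    · exact Eventually.of_forall fun w => h1 v w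
  -- Step 4: uniform bound on the `w`-integrals.
  have h2b : ∀ n (v : V3), ‖∫ w, ∫ ω : Metric.sphere (0 : V3) 1, hardSphereKernel (v, w) ω *
      (g n (collide ω (v, w)).1 + g n (collide ω (v, w)).2 - g n v - g n w) ∂sphereMeasure ∂m‖ ≤
      S * (4 * (m.real univ * ‖v‖ + ∫ w, ‖w‖ ∂m)) := by
    intro n v
    calc ‖∫ w, ∫ ω : Metric.sphere (0 : V3) 1, hardSphereKernel (v, w) ω *
          (g n (collide ω (v, w)).1 + g n (collide ω (v, w)).2 - g n v - g n w) ∂sphereMeasure ∂m‖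
        ≤ ∫ w, S * (4 * (‖v‖ + ‖w‖)) ∂m :=
          norm_integral_le_of_norm_le (hbi v) (Eventually.of_forall fun w => h1b n v w)
      _ = S * (4 * (m.real univ * ‖v‖ + ∫ w, ‖w‖ ∂m)) := by
          rw [integral_const_mul, integral_const_mul, integral_add (integrable_const _) hm,
            integral_const, smul_eq_mul]
  -- Step 5: the `v`-integrals converge.
  refine tendsto_integral_of_dominated_convergence
    (fun v => S * (4 * (m.real univ * ‖v‖ + ∫ w, ‖w‖ ∂m))) ?_ ?_ ?_ ?_
  · intro n
    exact ((continuous_sphereIntegral_balance (hg n)).stronglyMeasurable.integral_prod_right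
      (ν := m)).aestronglyMeasurable
  · exact (((hm.const_mul _).fun_add (integrable_const _)).const_mul 4).const_mul S
  · intro n
    exact Eventually.of_forall fun v => h2b n v
  · exact Eventually.of_forall fun v => h2 v

/-! ## The test family -/

/-- Registered stub `stub_balanceTestFamily` of skeleton v11 (line `Sketch`, crux stmt-AtomisticToContinuum-15141): there is a sequence `ψᵢ : ℝ³ → [−1, 1]` of continuous functions such that a finite measure with finite second moment whose collisional balance functional vanishes on every `ψᵢ` is balanced against ALL bounded continuous tests. [folklore] -/
theorem stub_balanceTestFamily :
    ∃ ψs : ℕ → V3 → ℝ, (∀ i, Continuous (ψs i)) ∧ (∀ i v, |ψs i v| ≤ 1) ∧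
      let Bal : (V3 → ℝ) → Measure V3 → ℝ := fun ψ m =>
        ∫ v, ∫ w, ∫ ω : Metric.sphere (0 : V3) 1,
          hardSphereKernel (v, w) ω * (ψ (collide ω (v, w)).1 + ψ (collide ω (v, w)).2 - ψ v - ψ w) ∂sphereMeasure ∂m ∂m
      ∀ m : Measure V3, IsFiniteMeasure m → Integrable (fun v : V3 => ‖v‖ ^ 2) m →
        (∀ i, Bal (ψs i) m = 0) →
        ∀ ψ : V3 → ℝ, Continuous ψ → (∃ C : ℝ, ∀ v, |ψ v| ≤ C) → Bal ψ m = 0 := by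
  -- the unit ball of `C(V3, ℝ)` for the sup norm, with the (second-countable) compact-open topology
  set U : Set C(V3, ℝ) := {f | ∀ v, |f v| ≤ 1}
  haveI : Nonempty U := ⟨⟨0, fun v => by simp⟩⟩
  obtain ⟨u, hu⟩ := TopologicalSpace.exists_dense_seq U
  refine ⟨fun i => ⇑(u i).1, fun i => (u i).1.continuous, fun i => (u i).2, ?_⟩
  intro Bal m hfin hm2 hBal ψ hψ hC
  obtain ⟨C, hC⟩ := hC
  have hC0 : 0 ≤ C := (abs_nonneg _).trans (hC 0)
  have hC1 : 0 < C + 1 := by linarith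
  -- the rescaled test `h = ψ / (C + 1)` lies in the unit ball
  set h : V3 → ℝ := fun v => (C + 1)⁻¹ * ψ v with hh_def
  have hhc : Continuous h := continuous_const.mul hψ
  have hhb : ∀ v, |h v| ≤ 1 := by
    intro v
    rw [hh_def, abs_mul, abs_inv, abs_of_pos hC1]
    calc (C + 1)⁻¹ * |ψ v| ≤ (C + 1)⁻¹ * (C + 1) :=
          mul_le_mul_of_nonneg_left ((hC v).trans (by linarith)) (inv_pos.2 hC1).le
      _ = 1 := inv_mul_cancel₀ hC1.ne'
  let f : U := ⟨⟨h, hhc⟩, hhb⟩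
  -- a subsequence of the dense family converging to `h` in the compact-open topology, hence pointwise
  have hf : f ∈ closure (range u) := by rw [hu.closure_range]; exact mem_univ _
  obtain ⟨x, hx1, hx2⟩ := mem_closure_iff_seq_limit.1 hf
  choose nk hnk using hx1
  have hpt : ∀ v, Tendsto (fun k => (x k : C(V3, ℝ)) v) atTop (𝓝 (h v)) := fun v =>
    ((continuous_eval_const v).tendsto (f : C(V3, ℝ))).comp
      ((continuous_subtype_val.tendsto f).comp hx2)
  -- the first moment of `m` is finite
  have hm1 : Integrable (fun v : V3 => ‖v‖) m :=
    ((integrable_const (1 : ℝ)).fun_add hm2).mono' continuous_norm.aestronglyMeasurable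
      (Eventually.of_forall fun v => by
        rw [norm_norm]
        nlinarith [norm_nonneg v, sq_nonneg (‖v‖ - 1)])
  -- continuity of the balance functional along the subsequence
  have hT : Tendsto (fun k => Bal (fun v => (x k : C(V3, ℝ)) v) m) atTop (𝓝 (Bal h m)) :=
    tendsto_balance hm1 (fun k => (x k).1.continuous) (fun k v => (x k).2 v) hpt
  have hzero : ∀ k, Bal (fun v => (x k : C(V3, ℝ)) v) m = 0 := by
    intro k
    have e : (fun v => (x k : C(V3, ℝ)) v) = (fun i => ⇑(u i).1) (nk k) := by
      simp only [hnk k]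
    rw [e]
    exact hBal (nk k)
  have hlim0 : Bal h m = 0 := tendsto_nhds_unique (hT.congr hzero) tendsto_const_nhds
  -- linearity in the test removes the rescaling
  have hlin : Bal h m = (C + 1)⁻¹ * Bal ψ m := by
    have e : ∀ k a b d e : ℝ, k * ((C + 1)⁻¹ * a + (C + 1)⁻¹ * b - (C + 1)⁻¹ * d - (C + 1)⁻¹ * e) =
        (C + 1)⁻¹ * (k * (a + b - d - e)) := fun k a b d e => by ring
    simp only [Bal, hh_def, e, integral_const_mul]
  rw [hlin] at hlim0
  exact (mul_eq_zero.1 hlim0).resolve_left (inv_ne_zero hC1.ne')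

end Summit.AtomisticToContinuum.HydrodynamicLimit.Theorems.ChaosClosesEulerBalanceTestFamily
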